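import Summits.NavierStokesRegularity.OSWSelfSimilar.SheetRResolventBounds
import Summits.NavierStokesRegularity.OSWSelfSimilar.SheetRResolventIdentity
import HarnessLib

/-!
# SHEET-ℝ frame: the Gårding datum of the sheet's own `B_λ` from the POINTWISE function `κ_λ`, and the resulting complex resolvent of
# `B_λ` on the half-plane `Re σ > −m`

HONEST FRAMING (cell ns-blowup GROUP B / zone Z3, cases Z3-SR-CERT ((C1)) and Z3-SR-SPEC ((P1) for the local part `B_λ`); 1-D MODEL certificate frame
(viscous gCLM/OSW sheet on the line); not Euler/NS; «violates: none — MODEL»). Nothing here asserts that a profile exists; the pointwise inequality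
`κ_λ ≥ m` (PRICE-impl1 (E3)/(C1): «κ_λ ≥ ¼ everywhere, min ¼ at ∞») is the HYPOTHESIS — interval arithmetic of the certificate.

`gardingData_sheet`: with `d = ½ξ + aU`, `V = 1 − h + λχ`, `U′ = h` continuous bounded, `U` bounded, `χ` a.e.-measurable bounded, and
`κ_λ(ξ) = (¾L² − 1 + ¼ξ²)/w − (1 + a/2)h − aξU/w + λχ ≥ m` at every `ξ`, the coefficient data form a `GardingData L d V (|a|U₀) ½ (1 + H₀ + |λ|X₀) m`;
hence (`sheet_resolvent`) the complex resolvent of `B_λ` exists on `Re σ > −m` as a `ℂ`-linear bounded operator on `L²_w(ℂ)` with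
`‖R(σ)G‖ ≤ ‖G‖/(m + Re σ)`, and `σ ↦ R(σ)` is a pseudo-resolvent, holomorphic there.  At the registered point `m = ¼`.
Pure bookkeeping over `SheetRLinearisedCoercivity` + `SheetRResolvent*`; no definition, no named fact.  WHAT THIS IS NOT: not NS; no number of
record moves.
-/

noncomputable section

namespace Summit.NavierStokesRegularity.OSWSelfSimilar
namespace SheetRSheetResolvent

open _root_.MeasureTheory _root_.Set _root_.Filter _root_.Real SheetRWeakProfilePV SheetRWeakToStrong SheetREnergyClass SheetRWeightedMeasure
  SheetRLinearisedTests SheetREnergySpace SheetRTestSpace SheetRLinearisedFormBounds SheetRSolutionOperator SheetRLinearisedCoercivity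
  SheetRComplexPivot SheetRResolventComplex SheetRResolventIdentity SheetRResolventBounds Literature.Analysis.OperatorTheory
open scoped Topology ENNReal

variable {L a lam m H₀ U₀ X₀ : ℝ} {U h χ : ℝ → ℝ}

/-- **The sheet's Gårding datum from `κ_λ ≥ m` pointwise.** [folklore] -/
theorem gardingData_sheet (hL : 0 < L) (hU : ∀ ξ, HasDerivAt U (h ξ) ξ) (hh : Continuous h) (hhb : ∀ ξ, |h ξ| ≤ H₀) (hU₀ : 0 ≤ U₀)
    (hUb : ∀ ξ, |U ξ| ≤ U₀) (hχm : AEStronglyMeasurable χ volume) (hχb : ∀ ξ, |χ ξ| ≤ X₀)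
    (hkappa : ∀ ξ, m ≤ (3 / 4 * L ^ 2 - 1 + ξ ^ 2 / 4) / (L ^ 2 + ξ ^ 2) - (1 + a / 2) * h ξ - a * ξ * U ξ / (L ^ 2 + ξ ^ 2) + lam * χ ξ) :
    GardingData L (fun ξ => ξ / 2 + a * U ξ) (fun ξ => 1 - h ξ + lam * χ ξ) (|a| * U₀) (1 / 2) (1 + H₀ + |lam| * X₀) m := by
  obtain ⟨hdC, hdd⟩ := sheet_drift_contDiff (a := a) hU hh
  have hdg : ∀ ξ, |ξ / 2 + a * U ξ| ≤ |a| * U₀ + 1 / 2 * |ξ| := fun ξ => by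
    calc |ξ / 2 + a * U ξ| ≤ |ξ / 2| + |a * U ξ| := abs_add_le _ _
      _ = 1 / 2 * |ξ| + |a| * |U ξ| := by rw [abs_div, abs_two, abs_mul]; ring
      _ ≤ 1 / 2 * |ξ| + |a| * U₀ := by nlinarith [hUb ξ, abs_nonneg a]
      _ = |a| * U₀ + 1 / 2 * |ξ| := by ring
  have hVm : AEStronglyMeasurable (fun ξ => 1 - h ξ + lam * χ ξ) volume :=
    (aestronglyMeasurable_const.sub hh.aestronglyMeasurable).add (aestronglyMeasurable_const.mul hχm)
  have hV : ∀ ξ, |1 - h ξ + lam * χ ξ| ≤ 1 + H₀ + |lam| * X₀ := fun ξ => by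
    calc |1 - h ξ + lam * χ ξ| ≤ |1 - h ξ| + |lam * χ ξ| := abs_add_le _ _
      _ ≤ (|(1:ℝ)| + |h ξ|) + |lam| * |χ ξ| := by rw [abs_mul]; exact add_le_add (abs_sub _ _) le_rfl
      _ ≤ (1 + H₀) + |lam| * X₀ := by
          rw [abs_one]; nlinarith [hhb ξ, hχb ξ, abs_nonneg lam]
  refine ⟨hdC.continuous.aestronglyMeasurable, hVm, by positivity, by norm_num, hdg, hV, ?_⟩
  refine garding_of_pointwise L hdC hVm hV (fun ξ => ?_)
  rw [sheet_potential_eq L hU hh ξ]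
  have hw : 0 < L ^ 2 + ξ ^ 2 := by positivity
  have hmul := mul_le_mul_of_nonneg_right (hkappa ξ) hw.le
  have e : ((3 / 4 * L ^ 2 - 1 + ξ ^ 2 / 4) / (L ^ 2 + ξ ^ 2) - (1 + a / 2) * h ξ - a * ξ * U ξ / (L ^ 2 + ξ ^ 2) + lam * χ ξ)
      * (L ^ 2 + ξ ^ 2) =
      (3 / 4 * L ^ 2 - 1 + ξ ^ 2 / 4) - (1 + a / 2) * ((L ^ 2 + ξ ^ 2) * h ξ) - a * ξ * U ξ + lam * ((L ^ 2 + ξ ^ 2) * χ ξ) := by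
    rw [add_mul, sub_mul, sub_mul, div_mul_cancel₀ _ hw.ne', div_mul_cancel₀ _ hw.ne']
    ring
  rw [e] at hmul
  linarith

/-- **The complex resolvent of the sheet's `B_λ` from the pointwise datum.**  Under the hypotheses of `gardingData_sheet`, for every `σ` with
`Re σ > −m` the operator `resolvent hL h σ` (with `h := gardingData_sheet …`) is a `ℂ`-linear bounded operator on `L²_w(ℂ)` with
`‖R(σ)G‖ ≤ ‖G‖/(m + Re σ)`; the family is a pseudo-resolvent on `{Re σ > −m}` and holomorphic there. [folklore] -/
theorem sheet_resolvent (hL : 0 < L) (hU : ∀ ξ, HasDerivAt U (h ξ) ξ) (hh : Continuous h) (hhb : ∀ ξ, |h ξ| ≤ H₀) (hU₀ : 0 ≤ U₀)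
    (hUb : ∀ ξ, |U ξ| ≤ U₀) (hχm : AEStronglyMeasurable χ volume) (hχb : ∀ ξ, |χ ξ| ≤ X₀)
    (hkappa : ∀ ξ, m ≤ (3 / 4 * L ^ 2 - 1 + ξ ^ 2 / 4) / (L ^ 2 + ξ ^ 2) - (1 + a / 2) * h ξ - a * ξ * U ξ / (L ^ 2 + ξ ^ 2) + lam * χ ξ) :
    (∀ (σ : ℂ), -m < σ.re → ∀ G : Wc L,
        ‖resolvent hL (gardingData_sheet hL hU hh hhb hU₀ hUb hχm hχb hkappa) σ G‖ ≤ ‖G‖ / (m + σ.re)) ∧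
      IsPseudoResolvent {σ : ℂ | -m < σ.re} (resolvent hL (gardingData_sheet hL hU hh hhb hU₀ hUb hχm hχb hkappa)) ∧
      DifferentiableOn ℂ (resolvent hL (gardingData_sheet hL hU hh hhb hU₀ hUb hχm hχb hkappa)) {σ : ℂ | -m < σ.re} :=
  ⟨fun _ hσ G => norm_resolvent_le_inv hL _ hσ G, isPseudoResolvent hL _, differentiableOn_resolvent hL _⟩

end SheetRSheetResolvent
end Summit.NavierStokesRegularity.OSWSelfSimilar

end
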